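import Literature.IUT.HodgeArakelov.ThetaEnvDataRecordAutOfInversion
import Literature.IUT.HodgeArakelov.EtaleThetaDataOfSettingAutActionTheta

/-!
# [IUTchII] Prop 3.4 (i) at the GENUINE data: binder (P4) (`θ`, `∞θ` stable) replaced by the [EtTh] Cor 2.19 (iii)-shape
# root hypothesis `hroot` at `Π^tp_{X̲̲}`

S. Mochizuki, *Inter-universal Teichmüller theory II*, kurims manuscript (Dec. 2020): Prop 3.4 (i) pp. 91–92
[cite: Mochizuki2012, Prop 3.4 (i) p.91]; Prop 1.4 p. 27 ("`Π ↦ θ(Π)` … cf. the constant multiple rigidity property of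
[EtTh], Corollary 2.19, (iii)").  Claim key DISPUTED (D-0012).  [EtTh] (refereed): Cor. 2.19 (iii) p. 65, Cor. 2.18 (i)
p. 60 (= FACT-LIST F-0620, BY NAME).  abc-iut cell, layer L6, WAVE-5 seat abc-iut-w5-d169, holder sub-row
«P34i-GENUINE-(P1)» of DAG node IUTchII:Prop3.4(i) (L6-lead §F v1.19s); `plan/L6/SUBDAG-IUTchII-Prop-31-33-34.md`; GAP rows
G-w5d169-1 (`hconj`), G-w5d169-2 (`hroot`).

PROOF-ONLY corollary (no definitions, no `Prop`-valued definition, no named fact) of abc-iut-w5-d169's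
`ThetaEnvDataRecordAutOfInversion.lean` (p430623) and `EtaleThetaDataOfSettingAutActionTheta.lean`: at abc-iut-w4-d030's
genuine `θ_env` record `EtaleLevels.thetaEnvData` (whose [IUTchII] Prop 1.4 output `D` IS
`etaleThetaDataOfSetting' C hC hS hcharY (setting …) refl rfl`), the binders (P4) `hθ` / `hinf` of
`prop34i_multiradiallyDefined_ofInversion` FOLLOW from the single top-level root hypothesis
`hroot : ∀ α ∈ Aut_top(Π^tp_{X̲̲}), ∃ τ ε, l•ε = 0 ∧ ρ^⊤_α η̲̈^Θ = conj_τ η̲̈^Θ + ε`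
(`image_toLim_theta_thetaEnvData_of_rootHyp`, `image_thetaInfty_thetaEnvData_of_rootHyp`), giving
**`EtaleLevels.prop34i_multiradiallyDefined_ofRootHyp`** — [IUTchII] Prop 3.4 (i) multiradiality AT THE GENUINE FUNCTOR
with residual exactly: F-0620 (named FACT) · `hq` (interface topology) · `hconj` (G-w5d169-1, ι-clause of Prop 2.2 (i)) ·
`hroot` (G-w5d169-2, [EtTh] Cor. 2.19 (iii) at `Π^tp_{X̲̲}`) · (P3) `hκ` (Kummer image stable, [AbsTopIII] §3 class) · the
record's standing inputs (`hcharY` = F-0620's `Π^tp_Ÿ`-clause, `hZ`, `hlim`, `mods`, …).  Finally (P3) itself is put in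
print's shape: `hκ` FOLLOWS from the EQUIVARIANCE of the constant-monoid Kummer map `κ` under some automorphism of the
constant monoid for each `α` (private `mrange_map_eq_of_equivariant`; [IUTchII] Prop 3.1 (ii) p. 88 / [AbsTopIII]
Prop 3.2: `Π ↦ M_TM(Π)` with its Kummer map is a functorial algorithm) — `prop34i_multiradiallyDefined_ofRootHypEquiv`
(GAP row G-w5d169-3 records the equivariance at the genuine Kummer map of abc-iut-w4-d007 / G-w4d019-1).
Nothing here asserts anything of [IUTchII]; no side taken on [IUTchIII] Cor 3.12; typed ≠ proved.
-/

noncomputable section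

open Topology

namespace Literature.IUT.HodgeArakelov

open Literature.AnabelianGeometry.EtaleTheta Literature.AnabelianGeometry.SemiGraphs
open CohomologySystemOfContH1 EtaleThetaDataOfSetting TemperedThetaMonoids
open scoped Literature.AnabelianGeometry.EtaleTheta

/-- **Image stability from equivariance** (generic): if a monoid homomorphism `κ : M → X` intertwines an automorphism
`f` of `X` with SOME automorphism `e` of `M` (`f (κ m) = κ (e m)`), then `f` carries the image of `κ` onto itself — the
shape in which print gives (P3): `Π ↦ (M_TM(Π), κ)` is a functorial algorithm ([AbsTopIII] Prop 3.2; [IUTchII] Prop 3.1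
(ii)). [folklore] -/
private theorem mrange_map_eq_of_equivariant {M X : Type*} [Monoid M] [Monoid X] (κ : M →* X) (f : X ≃* X)
    (e : M ≃* M) (h : ∀ m, f (κ m) = κ (e m)) : (MonoidHom.mrange κ).map (f : X →* X) = MonoidHom.mrange κ := by
  ext y
  constructor
  · rintro ⟨_, ⟨m, rfl⟩, rfl⟩
    exact ⟨e m, (h m).symm⟩
  · rintro ⟨m, rfl⟩
    refine ⟨κ (e.symm m), ⟨e.symm m, rfl⟩, ?_⟩
    change f (κ (e.symm m)) = κ m
    rw [h, MulEquiv.apply_symm_apply]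

namespace EtaleLevels

variable {p : ℕ} [Fact p.Prime] {D : Literature.AnabelianGeometry.EtaleTheta.ThetaSetting p}
  {E : D.EtaleThetaData} {l : ℕ} (C : E.DoubleUnderline l) (hC : D.Compat) (hS : D.Sec2Hyps)
  (hl : l.Prime) (hp2 : p ≠ 2) (hpl : p ≠ l) (hζ : ∃ ζ : D.K, IsPrimitiveRoot ζ (4 * l))
  (mods : ∀ M : ℕ+, D.CyclotomeMod l M)
  (f : contCocycles D.toTheta D.DeltaTheta C.GtpYdduu) (hf : f ∈ C.rootCocycles hC)
  (hmods : ∀ (M M' : ℕ+) (h : (M : ℕ) ∣ (M' : ℕ)) (x : D.lDeltaTheta l),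
    MuN.red p M M' h ((mods M').red x) = (mods M).red x)
  (h15 : Literature.AnabelianGeometry.EtaleTheta.ThetaSetting.Prop15iii E hC) (L : C.CuspLabels)
  (hZ : ∀ M : ℕ+, Nonempty (ModelCyclotomes.lDeltaQuot (C.rigidData (mods M) hC hS h15 L) ≃*
    Literature.IUT.HodgeTheaters.ZHat))
  (hcharY : EtaleThetaDataOfSetting.PiYddCharacteristic C)
  (hlim : Function.Bijective (rigidLimHom C hC hS hl hp2 hpl hζ mods f hf hmods h15 L hZ))
  [(EtaleThetaDataOfSetting.PiYdd C).Normal]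
  (hq : IsQuotientMap D.toTheta) {N : ℕ+} (μ : D.CyclotomeMod l N)
  (R : RigidData.{0} N l) (hR : R = C.rigidData μ hC hS h15 L) (h218i : R.Cor218_i)
  (hroot : ∀ α : (Pi C) ≃ₜ* (Pi C), ∃ τ : Pi C, ∃ ε : (coh C).H1 ⊤, l • ε = 0 ∧
    autActTopOfCor218i C hq μ hC hS h15 L R hR h218i α (rootTop C) =
      h1TopConjEquiv (phi C) (D.lDeltaTheta l) (PiYdd C) τ (rootTop C) + ε)

include hroot in
/-- **(P4), `θ`-part, at the genuine record**: `ρ_α` stabilises `toLim ⊤ '' θ(Π)` of abc-iut-w4-d030's `thetaEnvData` for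
every `α`, from `hroot`. [cite: Mochizuki2012, Prop 1.4 p.27] -/
theorem image_toLim_theta_thetaEnvData_of_rootHyp (α : (Pi C) ≃ₜ* (Pi C)) :
    autActOfCor218i C hq μ hC hS h15 L R hR h218i α ''
        ((thetaEnvData C hC hS hl hp2 hpl hζ mods f hf hmods h15 L hZ hcharY hlim).D.coh.toLim ⊤ ''
          (thetaEnvData C hC hS hl hp2 hpl hζ mods f hf hmods h15 L hZ hcharY hlim).D.theta) =
      (thetaEnvData C hC hS hl hp2 hpl hζ mods f hf hmods h15 L hZ hcharY hlim).D.coh.toLim ⊤ ''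
        (thetaEnvData C hC hS hl hp2 hpl hζ mods f hf hmods h15 L hZ hcharY hlim).D.theta :=
  image_autActOfCor218i_toLim_theta_of_rootHyp C hq μ hC hS h15 L R hR h218i hroot hcharY
    (setting C hC hS hl hp2 hpl hζ mods f hf) (ContinuousMulEquiv.refl _) rfl α

include hroot in
/-- **(P4), `∞θ`-part, at the genuine record**: `ρ_α` stabilises `∞θ(Π)` of `thetaEnvData` for every `α`, from `hroot`.
[cite: Mochizuki2012, Prop 1.4 p.27] -/
theorem image_thetaInfty_thetaEnvData_of_rootHyp (α : (Pi C) ≃ₜ* (Pi C)) :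
    autActOfCor218i C hq μ hC hS h15 L R hR h218i α ''
        (thetaEnvData C hC hS hl hp2 hpl hζ mods f hf hmods h15 L hZ hcharY hlim).D.thetaInfty =
      (thetaEnvData C hC hS hl hp2 hpl hζ mods f hf hmods h15 L hZ hcharY hlim).D.thetaInfty :=
  image_autActOfCor218i_thetaInfty_of_rootHyp C hq μ hC hS h15 L R hR h218i hroot hcharY
    (setting C hC hS hl hp2 hpl hζ mods f hf) (ContinuousMulEquiv.refl _) rfl α

variable {M : Type} [CommMonoid M]
  (κ : M →* Multiplicative (thetaEnvData C hC hS hl hp2 hpl hζ mods f hf hmods h15 L hZ hcharY hlim).cohEnv.lim)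
  (ι₀ : (Pi C) ≃ₜ* (Pi C))
  (hconj : ∀ α : (Pi C) ≃ₜ* (Pi C), ∃ c : Pi C, ∀ g, α (ι₀ (α.symm g)) = c * ι₀ (c⁻¹ * g * c) * c⁻¹)
  (hκ : ∀ α : (Pi C) ≃ₜ* (Pi C),
    (MonoidHom.mrange κ).map (AddEquiv.toMultiplicative (autActOfCor218i C hq μ hC hS h15 L R hR h218i α) :
      Multiplicative (h1Lim (phi C) (D.lDeltaTheta l) (PiYdd C) ⊥) →*
        Multiplicative (h1Lim (phi C) (D.lDeltaTheta l) (PiYdd C) ⊥)) = MonoidHom.mrange κ)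

/-- **[IUTchII] Prop 3.4 (i) — MULTIRADIALITY OF SPLIT THETA MONOIDS AT THE GENUINE FUNCTOR, `ι` ranging over the
`Π^tp_{X̲̲}`-conjugacy orbit of the action of ONE inversion automorphism `ι₀`, binders (P1), (P2), (P4) DISCHARGED resp.
REDUCED to print-shaped statements**: (P1) := {[EtTh] Cor. 2.18 (i) = F-0620, `hq`} (p429735), (P2) := `hconj`
(G-w5d169-1, p430185), (P4) := `hroot` (G-w5d169-2, this file); remaining binder: (P3) `hκ` (Kummer image stable).
[cite: Mochizuki2012, Prop 3.4 (i) p.92] -/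
theorem prop34i_multiradiallyDefined_ofRootHyp
    {η : (C.thetaEnvData μ hC hS).PiYdd → MuN p N} (hη : η ∈ (C.thetaEnvData μ hC hS).thetaCocycles)
    (Γ : Type) [Group Γ] :
    ((ex18iii (ThetaSetting.ofDoubleUnderline C μ hC hS hl hp2 hpl hζ hη) Γ).toDagger
      (TemperedThetaMonoids.prop34iRadialFunctor
        (thetaEnvTransportI C hC hS hl hp2 hpl hζ mods f hf hmods h15 L hZ hcharY hlim hq μ R hR h218i κ
          (autActOfCor218i C hq μ hC hS h15 L R hR h218i ι₀)
          (orbitHyp_of_iotaConj C hq μ hC hS h15 L R hR h218i ι₀ hconj) hκ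
          (image_toLim_theta_thetaEnvData_of_rootHyp C hC hS hl hp2 hpl hζ mods f hf hmods h15 L hZ hcharY hlim hq
            μ R hR h218i hroot)
          (image_thetaInfty_thetaEnvData_of_rootHyp C hC hS hl hp2 hpl hζ mods f hf hmods h15 L hZ hcharY hlim hq μ
            R hR h218i hroot) hη)
        Γ)).IsMultiradiallyDefined :=
  prop34i_multiradiallyDefined_ofInversion C hC hS hl hp2 hpl hζ mods f hf hmods h15 L hZ hcharY hlim hq μ R hR h218i κ
    ι₀ hconj hκ _ _ hη Γ

omit hκ [(EtaleThetaDataOfSetting.PiYdd C).Normal] in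
/-- **(P3) in print's shape**: if for every `α ∈ Aut_top(Π^tp_{X̲̲})` the Kummer map `κ` of the constant monoid intertwines
`ρ_α` with SOME automorphism of the constant monoid (functoriality of `Π ↦ (M_TM(Π), κ)`, [AbsTopIII] Prop. 3.2 / [IUTchII]
Prop. 3.1 (ii)), then `ρ_α` carries `Ψ_cns = κ(M)` onto itself — binder (P3) `hκ`. [cite: Mochizuki2012, Prop 3.1 (ii) p.88] -/
theorem kummerImage_stable_of_equivariant
    (hequiv : ∀ α : (Pi C) ≃ₜ* (Pi C), ∃ e : M ≃* M, ∀ m : M,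
      AddEquiv.toMultiplicative (autActOfCor218i C hq μ hC hS h15 L R hR h218i α) (κ m) = κ (e m))
    (α : (Pi C) ≃ₜ* (Pi C)) :
    (MonoidHom.mrange κ).map (AddEquiv.toMultiplicative (autActOfCor218i C hq μ hC hS h15 L R hR h218i α) :
      Multiplicative (h1Lim (phi C) (D.lDeltaTheta l) (PiYdd C) ⊥) →*
        Multiplicative (h1Lim (phi C) (D.lDeltaTheta l) (PiYdd C) ⊥)) = MonoidHom.mrange κ := by
  obtain ⟨e, he⟩ := hequiv α
  exact mrange_map_eq_of_equivariant κ _ e he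

omit hκ in
/-- **[IUTchII] Prop 3.4 (i) at the genuine functor with ALL FOUR binders of p423712 in print's shape**: (P1) := {F-0620,
`hq`}; (P2) := `hconj` (G-w5d169-1); (P3) := `hequiv` (equivariance of the constant-monoid Kummer map, G-w5d169-3);
(P4) := `hroot` (G-w5d169-2). [cite: Mochizuki2012, Prop 3.4 (i) p.92] -/
theorem prop34i_multiradiallyDefined_ofRootHypEquiv
    (hequiv : ∀ α : (Pi C) ≃ₜ* (Pi C), ∃ e : M ≃* M, ∀ m : M,
      AddEquiv.toMultiplicative (autActOfCor218i C hq μ hC hS h15 L R hR h218i α) (κ m) = κ (e m))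
    {η : (C.thetaEnvData μ hC hS).PiYdd → MuN p N} (hη : η ∈ (C.thetaEnvData μ hC hS).thetaCocycles)
    (Γ : Type) [Group Γ] :
    ((ex18iii (ThetaSetting.ofDoubleUnderline C μ hC hS hl hp2 hpl hζ hη) Γ).toDagger
      (TemperedThetaMonoids.prop34iRadialFunctor
        (thetaEnvTransportI C hC hS hl hp2 hpl hζ mods f hf hmods h15 L hZ hcharY hlim hq μ R hR h218i κ
          (autActOfCor218i C hq μ hC hS h15 L R hR h218i ι₀)
          (orbitHyp_of_iotaConj C hq μ hC hS h15 L R hR h218i ι₀ hconj)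
          (kummerImage_stable_of_equivariant C hC hS hl hp2 hpl hζ mods f hf hmods h15 L hZ hcharY hlim hq μ R hR h218i κ
            hequiv)
          (image_toLim_theta_thetaEnvData_of_rootHyp C hC hS hl hp2 hpl hζ mods f hf hmods h15 L hZ hcharY hlim hq
            μ R hR h218i hroot)
          (image_thetaInfty_thetaEnvData_of_rootHyp C hC hS hl hp2 hpl hζ mods f hf hmods h15 L hZ hcharY hlim hq μ
            R hR h218i hroot) hη)
        Γ)).IsMultiradiallyDefined :=
  prop34i_multiradiallyDefined_ofInversion C hC hS hl hp2 hpl hζ mods f hf hmods h15 L hZ hcharY hlim hq μ R hR h218i κ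
    ι₀ hconj _ _ _ hη Γ

end EtaleLevels

end Literature.IUT.HodgeArakelov

end
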